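import Mathlib
import Summits.ValiantsHypothesis.ValiantsHypothesis.Theorems.LacunarySymmetroidMatrixDescartesMonotoneFlagCore
import Summits.ValiantsHypothesis.ValiantsHypothesis.Theorems.LacunarySymmetroidMatrixDescartesGramDualHaynsworth

/-!
# `MatrixDescartes` (stmt-ValiantsHypothesis-18050) — FLAG FORM OF THE EXACT MONOTONE COUNT, II: THE END INERTIAS OF THE MONOTONE
# SECTOR WITH FULLY DEGENERATE LETTERS (`ν(F(∞)) ≤ ν̄(S₀|W_U)`, `ν(F(0⁺)) ≥ codim W_L + ν(S₀|W_L)`, no `det` hypothesis)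

HONEST FRAMING.  Cell `pub-symmetroid`, seat `val-sym-mdr-p2` (gen 22); helper file `--supports` the crux
`Theses.LacunarySymmetroid.MatrixDescartes` (OPEN), NO closure claim.  Second part of the flag form of the exact monotone count (part I =
`…MonotoneFlagCore`, the one-rate core lemma; the bound = `…MonotoneFlag`; the assembly = `…MonotoneFlagExact`).  STRUCTURE theorems
(end inertias of a pencil from letter data) beside the crux: nothing here bears on the crux in its window, `stub_twoSided`,
`DoorA26` / `DoorA34`, registers, or `VP ≠ VNP`.

SETTING (crux currency).  Real symmetric letters `S l`, exponents `d l`, pivot index `l₀`, `S₀ := S l₀` ARBITRARY; MONOTONE SECTOR: every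
other letter PSD with `d l > d l₀` (UPPER) or NSD with `d l < d l₀` (LOWER); `F(x) = Σ_l x^{d l} S l`.  `B_U : ι × α` a FULL BASIS of
`W_U = ⋂_{upper} ker S l` (killed by every upper letter; its range contains every vector killed by all upper letters); likewise
`B_L : ι × β` for `W_L`; `C_U = B_Uᵀ S₀ B_U`, `C_L = B_Lᵀ S₀ B_L`.

* `sum_letters_split` — `Σ_l f l = f l₀ + Σ_upper + Σ_lower`.
* **`eventually_negIndex_add_posIndex_le_card` (END INERTIA AT INFINITY, upper side).**  `∃ X, ∀ x ≥ X: ν(F(x)) + π(C_U) ≤ card α`.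
  PROOF: `P := Σ_upper S l ⪰ 0`, `N := −Σ_lower S l`; for `x ≥ 1`, `vᵀF(x)v ≥ x^{d₀}·vᵀ(x•P + S₀ − x⁻¹•N)v` termwise (`x^{d_l} ≥ x^{d₀+1}`
  on upper, `x^{d_l} ≤ x^{d₀−1}` on lower letters); the CORE LEMMA (`…MonotoneFlagCore`) makes «positive eigenvectors of `P`» ⊔ «`B_U`·positive
  eigenvectors of `C_U`» a positive family for the one-rate pencil, hence for `F(x)`; Sylvester in family language
  (`Inertia.card_le_posIndex`) gives `π(F(x)) ≥ π(P) + π(C_U)`, and `π(P) ≥ card ι − card α` because `ker P ⊆ W_U = range B_U`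
  (`card_le_posIndex_add_card_of_ker_subset_range`).
* **`eventually_card_add_negIndex_le_negIndex_add_card` (END INERTIA AT ZERO, lower side).**  `∃ ε > 0, ∀ x ∈ (0, ε]:
  card ι + ν(C_L) ≤ ν(F(x)) + card β`.  PROOF: the core lemma for the triple `(N, −S₀, P)` at `y = x⁻¹` and the mirror comparison
  `vᵀF(x)v ≤ −x^{d₀}·vᵀ(x⁻¹•N − S₀ − x•P)v` for `x ≤ 1` give a NEGATIVE family of size `π(N) + π(−C_L) = π(N) + ν(C_L)`
  (`Inertia.card_le_negIndex`, `negIndex_neg_eq_posIndex`), and `π(N) ≥ card ι − card β`.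
Together with the two UNIFORM inequalities of `…MonotoneFlag` (`ν(F(x)) + π(C_U) ≥ card α` at every non-singular `x`,
`ν(F(x)) + card β ≤ card ι + ν(C_L)` at every `x`) these are EQUALITIES at the two ends: `ν(F(∞)) = dim W_U − π(S₀|W_U)`,
`ν(F(0⁺)) = codim W_L + ν(S₀|W_L)` — the end inertias of a monotone pencil with ARBITRARILY degenerate letters, with no flag and no
Gram matrix (the item «general k-step flag, NOT filed» of memo MONOTONE-EXACT.md §4 (L2), settled on the monotone sector).

[folklore] (Sylvester's law of inertia in family language; persistence).  Axioms `propext`, `Classical.choice`, `Quot.sound`.  No definitions.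
-/

-- layout Summits/ValiantsHypothesis/ValiantsHypothesis forces the duplicated namespace component
set_option linter.dupNamespace false

namespace Summit.ValiantsHypothesis.ValiantsHypothesis.Theorems.LacunarySymmetroidMatrixDescartes

open Polynomial Matrix Finset
open scoped BigOperators Topology

namespace GramDual

/-! ## §3 The end inertias on the monotone sector -/

section EndInertias

variable {ι κ : Type} [Fintype ι] [DecidableEq ι] [Fintype κ] [DecidableEq κ]

/-- Three-way split of a sum over the letters: pivot, upper, lower. [folklore] -/
theorem sum_letters_split (d : κ → ℕ) (l₀ : κ) (hd : ∀ l, l ≠ l₀ → d l₀ < d l ∨ d l < d l₀) (f : κ → ℝ) :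
    ∑ l, f l = f l₀ + ∑ l ∈ Finset.univ.filter (fun l => d l₀ < d l), f l
      + ∑ l ∈ Finset.univ.filter (fun l => d l < d l₀), f l := by
  classical
  rw [← Finset.sum_filter_add_sum_filter_not Finset.univ (fun l => d l₀ < d l) f,
    ← Finset.sum_filter_add_sum_filter_not (Finset.univ.filter fun l => ¬ d l₀ < d l) (fun l => d l < d l₀) f,
    Finset.filter_filter, Finset.filter_filter]
  have h1 : Finset.univ.filter (fun l => ¬ d l₀ < d l ∧ d l < d l₀) = Finset.univ.filter (fun l => d l < d l₀) := by
    ext l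
    simp only [Finset.mem_filter, Finset.mem_univ, true_and]
    exact ⟨fun h => h.2, fun h => ⟨not_lt.2 h.le, h⟩⟩
  have h2 : Finset.univ.filter (fun l => ¬ d l₀ < d l ∧ ¬ d l < d l₀) = {l₀} := by
    ext l
    simp only [Finset.mem_filter, Finset.mem_univ, true_and, Finset.mem_singleton]
    constructor
    · intro h
      by_contra hl
      rcases hd l hl with h' | h'
      · exact h.1 h'
      · exact h.2 h'
    · intro h
      rw [h]
      exact ⟨lt_irrefl _, lt_irrefl _⟩
  rw [h1, h2, Finset.sum_singleton]
  ring

/-- **END INERTIA AT INFINITY, upper side (no `det` hypothesis).**  Monotone sector; `B_U` a FULL basis of the joint kernel of the upper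
letters (injective, killed by every upper letter, and spanning).  Then `ν(F(x)) + π(C_U) ≤ card α` for all large `x`. [folklore] -/
theorem eventually_negIndex_add_posIndex_le_card (d : κ → ℕ) (S : κ → Matrix ι ι ℝ) (hS : ∀ l, (S l).IsSymm) (l₀ : κ)
    (hmono : ∀ l, l ≠ l₀ → ((S l).PosSemidef ∧ d l₀ < d l) ∨ ((-(S l)).PosSemidef ∧ d l < d l₀))
    {α : Type} [Fintype α] [DecidableEq α] (BU : Matrix ι α ℝ) (hBU : ∀ l, d l₀ < d l → S l * BU = 0)
    (hBUspan : ∀ v : ι → ℝ, (∀ l, d l₀ < d l → S l *ᵥ v = 0) → ∃ c : α → ℝ, BU *ᵥ c = v)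
    (hCU : (BUᵀ * S l₀ * BU).IsHermitian) :
    ∃ X : ℝ, 0 < X ∧ ∀ x : ℝ, X ≤ x →
      Fintype.card {j // (Inertia.isHermitian_pencil d S hS x).eigenvalues j < 0}
        + Fintype.card {j // 0 < hCU.eigenvalues j} ≤ Fintype.card α := by
  classical
  set P : Matrix ι ι ℝ := ∑ l ∈ Finset.univ.filter (fun l => d l₀ < d l), S l with hPdef
  set N : Matrix ι ι ℝ := ∑ l ∈ Finset.univ.filter (fun l => d l < d l₀), -(S l) with hNdef
  have hPpsd : P.PosSemidef := by
    rw [hPdef]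
    refine Matrix.posSemidef_sum _ fun l hl => ?_
    rw [Finset.mem_filter] at hl
    by_cases hl0 : l = l₀
    · rw [hl0] at hl; exact absurd hl.2 (lt_irrefl _)
    rcases hmono l hl0 with ⟨h, _⟩ | ⟨_, h⟩
    · exact h
    · exact absurd hl.2 (lt_asymm h)
  have hPh : P.IsHermitian := hPpsd.1
  have hPB : P * BU = 0 := by
    rw [hPdef, Matrix.sum_mul]
    exact Finset.sum_eq_zero fun l hl => hBU l (Finset.mem_filter.1 hl).2
  obtain ⟨Y, hY, hfam⟩ := eventually_pos_family_oneRate P (S l₀) N hPh BU hPB hCU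
  refine ⟨max Y 1, lt_max_of_lt_left hY, fun x hx => ?_⟩
  have hxY : Y ≤ x := le_trans (le_max_left _ _) hx
  have hx1 : 1 ≤ x := le_trans (le_max_right _ _) hx
  have hxpos : 0 < x := by linarith
  set hF := Inertia.isHermitian_pencil d S hS x
  -- the family is positive for `F(x)`: comparison with the one-rate pencil at `y = x`
  have hd : ∀ l, l ≠ l₀ → d l₀ < d l ∨ d l < d l₀ := fun l hl => (hmono l hl).imp (fun h => h.2) (fun h => h.2)
  have hcmp : ∀ v : ι → ℝ, x ^ d l₀ * (v ⬝ᵥ ((x • P + S l₀ - x⁻¹ • N) *ᵥ v)) ≤ v ⬝ᵥ ((∑ l, x ^ d l • S l) *ᵥ v) := by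
    intro v
    have hq : v ⬝ᵥ ((∑ l, x ^ d l • S l) *ᵥ v) = ∑ l, x ^ d l * (v ⬝ᵥ (S l *ᵥ v)) := by
      simp only [Matrix.sum_mulVec, dotProduct_sum, Matrix.smul_mulVec, dotProduct_smul, smul_eq_mul]
    rw [hq, sum_letters_split d l₀ hd]
    have hP' : v ⬝ᵥ (P *ᵥ v) = ∑ l ∈ Finset.univ.filter (fun l => d l₀ < d l), v ⬝ᵥ (S l *ᵥ v) := by
      simp only [hPdef, Matrix.sum_mulVec, dotProduct_sum]
    have hN' : v ⬝ᵥ (N *ᵥ v) = -∑ l ∈ Finset.univ.filter (fun l => d l < d l₀), v ⬝ᵥ (S l *ᵥ v) := by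
      simp only [hNdef, Matrix.sum_mulVec, dotProduct_sum, Matrix.neg_mulVec, dotProduct_neg, Finset.sum_neg_distrib]
    have hexp : x ^ d l₀ * (v ⬝ᵥ ((x • P + S l₀ - x⁻¹ • N) *ᵥ v))
        = x ^ d l₀ * (v ⬝ᵥ (S l₀ *ᵥ v)) + ∑ l ∈ Finset.univ.filter (fun l => d l₀ < d l), x ^ d l₀ * x * (v ⬝ᵥ (S l *ᵥ v))
          + ∑ l ∈ Finset.univ.filter (fun l => d l < d l₀), x ^ d l₀ * x⁻¹ * (v ⬝ᵥ (S l *ᵥ v)) := by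
      have e1 : ∑ l ∈ Finset.univ.filter (fun l => d l₀ < d l), x ^ d l₀ * x * (v ⬝ᵥ (S l *ᵥ v))
          = x ^ d l₀ * x * ∑ l ∈ Finset.univ.filter (fun l => d l₀ < d l), v ⬝ᵥ (S l *ᵥ v) := by rw [Finset.mul_sum]
      have e2 : ∑ l ∈ Finset.univ.filter (fun l => d l < d l₀), x ^ d l₀ * x⁻¹ * (v ⬝ᵥ (S l *ᵥ v))
          = x ^ d l₀ * x⁻¹ * ∑ l ∈ Finset.univ.filter (fun l => d l < d l₀), v ⬝ᵥ (S l *ᵥ v) := by rw [Finset.mul_sum]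
      rw [e1, e2]
      simp only [Matrix.sub_mulVec, Matrix.add_mulVec, Matrix.smul_mulVec, dotProduct_sub, dotProduct_add,
        dotProduct_smul, smul_eq_mul, hP', hN']
      ring
    rw [hexp]
    have hup : ∀ l ∈ Finset.univ.filter (fun l => d l₀ < d l),
        x ^ d l₀ * x * (v ⬝ᵥ (S l *ᵥ v)) ≤ x ^ d l * (v ⬝ᵥ (S l *ᵥ v)) := by
      intro l hl
      have hdl := (Finset.mem_filter.1 hl).2
      have hl0 : l ≠ l₀ := fun h => by rw [h] at hdl; exact lt_irrefl _ hdl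
      have hq0 : 0 ≤ v ⬝ᵥ (S l *ᵥ v) := by
        rcases hmono l hl0 with ⟨hpsd, _⟩ | ⟨_, h⟩
        · simpa only [star_trivial] using hpsd.dotProduct_mulVec_nonneg v
        · exact absurd hdl (lt_asymm h)
      have hpow : x ^ d l₀ * x ≤ x ^ d l := by
        rw [← pow_succ]
        exact pow_le_pow_right₀ hx1 (by omega)
      exact mul_le_mul_of_nonneg_right hpow hq0
    have hlow : ∀ l ∈ Finset.univ.filter (fun l => d l < d l₀),
        x ^ d l₀ * x⁻¹ * (v ⬝ᵥ (S l *ᵥ v)) ≤ x ^ d l * (v ⬝ᵥ (S l *ᵥ v)) := by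
      intro l hl
      have hdl := (Finset.mem_filter.1 hl).2
      have hl0 : l ≠ l₀ := fun h => by rw [h] at hdl; exact lt_irrefl _ hdl
      have hq0 : v ⬝ᵥ (S l *ᵥ v) ≤ 0 := by
        rcases hmono l hl0 with ⟨_, h⟩ | ⟨hnsd, _⟩
        · exact absurd hdl (lt_asymm h)
        · have h := hnsd.dotProduct_mulVec_nonneg v
          simp only [star_trivial, Matrix.neg_mulVec, dotProduct_neg] at h
          linarith
      have hpow : x ^ d l ≤ x ^ d l₀ * x⁻¹ := by
        rw [le_mul_inv_iff₀ hxpos, ← pow_succ]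
        exact pow_le_pow_right₀ hx1 (by omega)
      exact mul_le_mul_of_nonpos_right hpow hq0
    have h1 := Finset.sum_le_sum hup
    have h2 := Finset.sum_le_sum hlow
    linarith
  have hposF : ∀ c : ({i // 0 < hPh.eigenvalues i} ⊕ {j // 0 < hCU.eigenvalues j}) → ℝ, c ≠ 0 →
      0 < (∑ k, c k • Sum.elim (fun i : {i // 0 < hPh.eigenvalues i} => (hPh.eigenvectorBasis i.1).ofLp)
            (fun j : {j // 0 < hCU.eigenvalues j} => BU *ᵥ (hCU.eigenvectorBasis j.1).ofLp) k) ⬝ᵥ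
          ((∑ l, x ^ d l • S l) *ᵥ ∑ k, c k • Sum.elim (fun i : {i // 0 < hPh.eigenvalues i} => (hPh.eigenvectorBasis i.1).ofLp)
            (fun j : {j // 0 < hCU.eigenvalues j} => BU *ᵥ (hCU.eigenvectorBasis j.1).ofLp) k) := by
    intro c hc
    have h := hfam x hxY c hc
    have hxp : 0 < x ^ d l₀ := pow_pos hxpos _
    exact lt_of_lt_of_le (mul_pos hxp h) (hcmp _)
  have hcount := Inertia.card_le_posIndex hF _ hposF
  rw [Fintype.card_sum] at hcount
  have hidx := (Inertia.negIndex_add_posIndex_add_corank hF).1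
  -- spanning count for `P`
  have hspanP : ∀ v : ι → ℝ, P *ᵥ v = 0 → ∃ c : α → ℝ, BU *ᵥ c = v := by
    intro v hv
    refine hBUspan v fun l hdl => ?_
    have hl0 : l ≠ l₀ := fun h => by rw [h] at hdl; exact lt_irrefl _ hdl
    have hpsd : (S l).PosSemidef := by
      rcases hmono l hl0 with ⟨h, _⟩ | ⟨_, h⟩
      · exact h
      · exact absurd hdl (lt_asymm h)
    -- `0 = vᵀPv = Σ vᵀS_l v` with non-negative terms
    have hsum : ∑ l ∈ Finset.univ.filter (fun l => d l₀ < d l), v ⬝ᵥ (S l *ᵥ v) = 0 := by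
      have h := congrArg (fun w => v ⬝ᵥ w) hv
      simp only [hPdef, Matrix.sum_mulVec, dotProduct_sum, dotProduct_zero] at h
      exact h
    have hnn : ∀ l ∈ Finset.univ.filter (fun l => d l₀ < d l), 0 ≤ v ⬝ᵥ (S l *ᵥ v) := by
      intro l' hl'
      have hdl' := (Finset.mem_filter.1 hl').2
      have hl0' : l' ≠ l₀ := fun h => by rw [h] at hdl'; exact lt_irrefl _ hdl'
      rcases hmono l' hl0' with ⟨hpsd', _⟩ | ⟨_, h⟩
      · simpa only [star_trivial] using hpsd'.dotProduct_mulVec_nonneg v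
      · exact absurd hdl' (lt_asymm h)
    have h0 := (Finset.sum_eq_zero_iff_of_nonneg hnn).1 hsum l (Finset.mem_filter.2 ⟨Finset.mem_univ _, hdl⟩)
    exact mulVec_eq_zero_of_form_eq_zero hpsd v h0
  have hspan := card_le_posIndex_add_card_of_ker_subset_range hPpsd hPh BU hspanP
  omega

/-- **END INERTIA AT ZERO, lower side (no `det` hypothesis).**  Monotone sector; `B_L` a FULL basis of the joint kernel of the lower letters.
Then `card ι + ν(C_L) ≤ ν(F(x)) + card β` for all small `x > 0` (the core lemma for `(N, −S₀, P)` gives a negative family). [folklore] -/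
theorem eventually_card_add_negIndex_le_negIndex_add_card (d : κ → ℕ) (S : κ → Matrix ι ι ℝ) (hS : ∀ l, (S l).IsSymm) (l₀ : κ)
    (hmono : ∀ l, l ≠ l₀ → ((S l).PosSemidef ∧ d l₀ < d l) ∨ ((-(S l)).PosSemidef ∧ d l < d l₀))
    {β : Type} [Fintype β] [DecidableEq β] (BL : Matrix ι β ℝ) (hBL : ∀ l, d l < d l₀ → S l * BL = 0)
    (hBLspan : ∀ v : ι → ℝ, (∀ l, d l < d l₀ → S l *ᵥ v = 0) → ∃ c : β → ℝ, BL *ᵥ c = v)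
    (hCL : (BLᵀ * S l₀ * BL).IsHermitian) :
    ∃ ε : ℝ, 0 < ε ∧ ∀ x : ℝ, 0 < x → x ≤ ε →
      Fintype.card ι + Fintype.card {j // hCL.eigenvalues j < 0}
        ≤ Fintype.card {j // (Inertia.isHermitian_pencil d S hS x).eigenvalues j < 0} + Fintype.card β := by
  classical
  set P : Matrix ι ι ℝ := ∑ l ∈ Finset.univ.filter (fun l => d l₀ < d l), S l with hPdef
  set N : Matrix ι ι ℝ := ∑ l ∈ Finset.univ.filter (fun l => d l < d l₀), -(S l) with hNdef
  have hNpsd : N.PosSemidef := by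
    rw [hNdef]
    refine Matrix.posSemidef_sum _ fun l hl => ?_
    rw [Finset.mem_filter] at hl
    by_cases hl0 : l = l₀
    · rw [hl0] at hl; exact absurd hl.2 (lt_irrefl _)
    rcases hmono l hl0 with ⟨_, h⟩ | ⟨h, _⟩
    · exact absurd hl.2 (lt_asymm h)
    · exact h
  have hNh : N.IsHermitian := hNpsd.1
  have hNB : N * BL = 0 := by
    rw [hNdef, Matrix.sum_mul]
    exact Finset.sum_eq_zero fun l hl => by rw [Matrix.neg_mul, hBL l (Finset.mem_filter.1 hl).2, neg_zero]
  have hCL' : (BLᵀ * (-(S l₀)) * BL).IsHermitian := isHermitian_compression (hS l₀).neg BL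
  have hCLeq : BLᵀ * (-(S l₀)) * BL = -(BLᵀ * S l₀ * BL) := by rw [Matrix.mul_neg, Matrix.neg_mul]
  obtain ⟨Y, hY, hfam⟩ := eventually_pos_family_oneRate N (-(S l₀)) P hNh BL hNB hCL'
  refine ⟨min Y⁻¹ 1, lt_min (inv_pos.2 hY) one_pos, fun x hxpos hx => ?_⟩
  have hx1 : x ≤ 1 := le_trans hx (min_le_right _ _)
  have hxY : Y ≤ x⁻¹ := (le_inv_comm₀ hY hxpos).2 (le_trans hx (min_le_left _ _))
  set hF := Inertia.isHermitian_pencil d S hS x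
  have hd : ∀ l, l ≠ l₀ → d l₀ < d l ∨ d l < d l₀ := fun l hl => (hmono l hl).imp (fun h => h.2) (fun h => h.2)
  -- comparison: `vᵀF(x)v ≤ -x^{d₀}·vᵀ(x⁻¹•N − S₀ − x•P)v`
  have hcmp : ∀ v : ι → ℝ, v ⬝ᵥ ((∑ l, x ^ d l • S l) *ᵥ v)
      ≤ -(x ^ d l₀ * (v ⬝ᵥ ((x⁻¹ • N + -(S l₀) - x⁻¹⁻¹ • P) *ᵥ v))) := by
    intro v
    have hq : v ⬝ᵥ ((∑ l, x ^ d l • S l) *ᵥ v) = ∑ l, x ^ d l * (v ⬝ᵥ (S l *ᵥ v)) := by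
      simp only [Matrix.sum_mulVec, dotProduct_sum, Matrix.smul_mulVec, dotProduct_smul, smul_eq_mul]
    rw [hq, sum_letters_split d l₀ hd]
    have hP' : v ⬝ᵥ (P *ᵥ v) = ∑ l ∈ Finset.univ.filter (fun l => d l₀ < d l), v ⬝ᵥ (S l *ᵥ v) := by
      simp only [hPdef, Matrix.sum_mulVec, dotProduct_sum]
    have hN' : v ⬝ᵥ (N *ᵥ v) = -∑ l ∈ Finset.univ.filter (fun l => d l < d l₀), v ⬝ᵥ (S l *ᵥ v) := by
      simp only [hNdef, Matrix.sum_mulVec, dotProduct_sum, Matrix.neg_mulVec, dotProduct_neg, Finset.sum_neg_distrib]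
    have hexp : -(x ^ d l₀ * (v ⬝ᵥ ((x⁻¹ • N + -(S l₀) - x⁻¹⁻¹ • P) *ᵥ v)))
        = x ^ d l₀ * (v ⬝ᵥ (S l₀ *ᵥ v)) + ∑ l ∈ Finset.univ.filter (fun l => d l₀ < d l), x ^ d l₀ * x * (v ⬝ᵥ (S l *ᵥ v))
          + ∑ l ∈ Finset.univ.filter (fun l => d l < d l₀), x ^ d l₀ * x⁻¹ * (v ⬝ᵥ (S l *ᵥ v)) := by
      have e1 : ∑ l ∈ Finset.univ.filter (fun l => d l₀ < d l), x ^ d l₀ * x * (v ⬝ᵥ (S l *ᵥ v))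
          = x ^ d l₀ * x * ∑ l ∈ Finset.univ.filter (fun l => d l₀ < d l), v ⬝ᵥ (S l *ᵥ v) := by rw [Finset.mul_sum]
      have e2 : ∑ l ∈ Finset.univ.filter (fun l => d l < d l₀), x ^ d l₀ * x⁻¹ * (v ⬝ᵥ (S l *ᵥ v))
          = x ^ d l₀ * x⁻¹ * ∑ l ∈ Finset.univ.filter (fun l => d l < d l₀), v ⬝ᵥ (S l *ᵥ v) := by rw [Finset.mul_sum]
      rw [e1, e2, inv_inv]
      simp only [Matrix.sub_mulVec, Matrix.add_mulVec, Matrix.smul_mulVec, Matrix.neg_mulVec, dotProduct_sub,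
        dotProduct_add, dotProduct_neg, dotProduct_smul, smul_eq_mul, hP', hN']
      ring
    rw [hexp]
    have hup : ∀ l ∈ Finset.univ.filter (fun l => d l₀ < d l),
        x ^ d l * (v ⬝ᵥ (S l *ᵥ v)) ≤ x ^ d l₀ * x * (v ⬝ᵥ (S l *ᵥ v)) := by
      intro l hl
      have hdl := (Finset.mem_filter.1 hl).2
      have hl0 : l ≠ l₀ := fun h => by rw [h] at hdl; exact lt_irrefl _ hdl
      have hq0 : 0 ≤ v ⬝ᵥ (S l *ᵥ v) := by
        rcases hmono l hl0 with ⟨hpsd, _⟩ | ⟨_, h⟩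
        · simpa only [star_trivial] using hpsd.dotProduct_mulVec_nonneg v
        · exact absurd hdl (lt_asymm h)
      have hpow : x ^ d l ≤ x ^ d l₀ * x := by
        rw [← pow_succ]
        exact pow_le_pow_of_le_one hxpos.le hx1 (by omega)
      exact mul_le_mul_of_nonneg_right hpow hq0
    have hlow : ∀ l ∈ Finset.univ.filter (fun l => d l < d l₀),
        x ^ d l * (v ⬝ᵥ (S l *ᵥ v)) ≤ x ^ d l₀ * x⁻¹ * (v ⬝ᵥ (S l *ᵥ v)) := by
      intro l hl
      have hdl := (Finset.mem_filter.1 hl).2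
      have hl0 : l ≠ l₀ := fun h => by rw [h] at hdl; exact lt_irrefl _ hdl
      have hq0 : v ⬝ᵥ (S l *ᵥ v) ≤ 0 := by
        rcases hmono l hl0 with ⟨_, h⟩ | ⟨hnsd, _⟩
        · exact absurd hdl (lt_asymm h)
        · have h := hnsd.dotProduct_mulVec_nonneg v
          simp only [star_trivial, Matrix.neg_mulVec, dotProduct_neg] at h
          linarith
      have hpow : x ^ d l₀ * x⁻¹ ≤ x ^ d l := by
        rw [mul_inv_le_iff₀ hxpos, ← pow_succ]
        exact pow_le_pow_of_le_one hxpos.le hx1 (by omega)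
      exact mul_le_mul_of_nonpos_right hpow hq0
    have h1 := Finset.sum_le_sum hup
    have h2 := Finset.sum_le_sum hlow
    linarith
  have hnegF : ∀ c : ({i // 0 < hNh.eigenvalues i} ⊕ {j // 0 < hCL'.eigenvalues j}) → ℝ, c ≠ 0 →
      (∑ k, c k • Sum.elim (fun i : {i // 0 < hNh.eigenvalues i} => (hNh.eigenvectorBasis i.1).ofLp)
            (fun j : {j // 0 < hCL'.eigenvalues j} => BL *ᵥ (hCL'.eigenvectorBasis j.1).ofLp) k) ⬝ᵥ
          ((∑ l, x ^ d l • S l) *ᵥ ∑ k, c k • Sum.elim (fun i : {i // 0 < hNh.eigenvalues i} => (hNh.eigenvectorBasis i.1).ofLp)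
            (fun j : {j // 0 < hCL'.eigenvalues j} => BL *ᵥ (hCL'.eigenvectorBasis j.1).ofLp) k) < 0 := by
    intro c hc
    have h := hfam x⁻¹ hxY c hc
    have hxp : 0 < x ^ d l₀ := pow_pos hxpos _
    have := hcmp (∑ k, c k • Sum.elim (fun i : {i // 0 < hNh.eigenvalues i} => (hNh.eigenvectorBasis i.1).ofLp)
            (fun j : {j // 0 < hCL'.eigenvalues j} => BL *ᵥ (hCL'.eigenvectorBasis j.1).ofLp) k)
    nlinarith [mul_pos hxp h]
  have hcount := Inertia.card_le_negIndex hF _ hnegF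
  rw [Fintype.card_sum] at hcount
  -- `π(−C_L) = ν(C_L)`
  have hneg : Fintype.card {j // 0 < hCL'.eigenvalues j} = Fintype.card {j // hCL.eigenvalues j < 0} := by
    have hCLn : (-(BLᵀ * S l₀ * BL)).IsHermitian := hCL.neg
    have hCLnn : (-(-(BLᵀ * S l₀ * BL))).IsHermitian := hCLn.neg
    have h1 := negIndex_neg_eq_posIndex hCLn hCLnn
    rw [Inertia.negIndex_congr hCLnn hCL (neg_neg _)] at h1
    rw [Inertia.posIndex_congr hCL' hCLn hCLeq, ← h1]
  -- spanning count for `N`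
  have hspanN : ∀ v : ι → ℝ, N *ᵥ v = 0 → ∃ c : β → ℝ, BL *ᵥ c = v := by
    intro v hv
    refine hBLspan v fun l hdl => ?_
    have hl0 : l ≠ l₀ := fun h => by rw [h] at hdl; exact lt_irrefl _ hdl
    have hnsd : (-(S l)).PosSemidef := by
      rcases hmono l hl0 with ⟨_, h⟩ | ⟨h, _⟩
      · exact absurd hdl (lt_asymm h)
      · exact h
    have hsum : ∑ l ∈ Finset.univ.filter (fun l => d l < d l₀), v ⬝ᵥ ((-(S l)) *ᵥ v) = 0 := by
      have h := congrArg (fun w => v ⬝ᵥ w) hv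
      simp only [hNdef, Matrix.sum_mulVec, dotProduct_sum, dotProduct_zero] at h
      exact h
    have hnn : ∀ l ∈ Finset.univ.filter (fun l => d l < d l₀), 0 ≤ v ⬝ᵥ ((-(S l)) *ᵥ v) := by
      intro l' hl'
      have hdl' := (Finset.mem_filter.1 hl').2
      have hl0' : l' ≠ l₀ := fun h => by rw [h] at hdl'; exact lt_irrefl _ hdl'
      rcases hmono l' hl0' with ⟨_, h⟩ | ⟨hnsd', _⟩
      · exact absurd hdl' (lt_asymm h)
      · simpa only [star_trivial] using hnsd'.dotProduct_mulVec_nonneg v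
    have h0 := (Finset.sum_eq_zero_iff_of_nonneg hnn).1 hsum l (Finset.mem_filter.2 ⟨Finset.mem_univ _, hdl⟩)
    have h := mulVec_eq_zero_of_form_eq_zero hnsd v h0
    rwa [Matrix.neg_mulVec, neg_eq_zero] at h
  have hspan := card_le_posIndex_add_card_of_ker_subset_range hNpsd hNh BL hspanN
  omega

end EndInertias



end GramDual

end Summit.ValiantsHypothesis.ValiantsHypothesis.Theorems.LacunarySymmetroidMatrixDescartes
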